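import Summits.Parity.GeneralizedHardyLittlewood.Theorems.GreenTaoLevelTwoGITwoCyclicInverseUniformRealisations
import Summits.Parity.GeneralizedHardyLittlewood.Theorems.GreenTaoLevelTwoGITwoCyclicInverseCorrelationCore

/-!
# Route `GreenTaoLevelTwo`, crux `GITwo` (stmt-Parity-21275), line `birth`, stub `stub_cyclicInverse`:
# realising the factorised bracket correlation on a nilmanifold FIXED IN ADVANCE (GT08a arXiv Thm. 68)

Helper toward the XL stub `stub_cyclicInverse` (B. Green, T. Tao, *An inverse theorem for the Gowers
`U³(G)` norm*, arXiv:math/0503014, Thm. 68 = PEMS 51 (2008) Thm. 12.8).  Block E17, third plumbing step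
("Lemma 69, together with another application of Lemma 65, confirms that the function (eq10.111) is an
elementary 2-step nilfunction … This completes the proof"): the stub quantifies the finite family of
nilmanifolds BEFORE `N`, so the product nilmanifold may depend only on the number `d` of frequencies.
For the explicit factor family `X_d` (a circle for the character, `d` tori `𝕋²` for the linear monomials,
`d²` copies of `𝕋² × (H_d × H_d)` for the quadratic monomials) and any `Z` with the universal tensoring
property of `exists_uniform_tensor`, the factorised correlation of `…BracketFactorised` is a real
`1`-bounded Lipschitz nilsequence correlation on `Z`, in the stub's shape.  Def-free:

* `exists_real_correlation_on` — `exists_real_correlation_of_factorised` with `Z` given first;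
* `inHeisClass_factorFamily` — the factor family lies in the Heisenberg class;
* `exists_real_correlation_of_bracket` — the statement described above, with the explicit Lipschitz
  constant `2π + d((L_κ+2π+2/(½−r₂))+2π) + d²(2(L_κ+2π+2/(½−r₂)) + 2(4π+L_κ+2/(½−r₂))L)`.

References: [GreenTao2008U3Inverse] arXiv:math/0503014, §12, Lemma 65, Lemma 69, proof of Thm. 68.
-/

noncomputable section

namespace Summit.Parity.GeneralizedHardyLittlewood.GreenTaoLevelTwoGITwoCyclicInverse

open Finset Literature.NumberTheory.Sieve
open Literature.NumberTheory.Sieve.GreenTaoLevelTwo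

/-- **From a factorised correlation to a real nilsequence correlation on a nilmanifold given in
advance.**  Same as `exists_real_correlation_of_factorised`, but the nilmanifold `Z` and its universal
tensoring property for the fixed factor family `X` (`exists_uniform_tensor`) are inputs, and each factor
`Gᵢ` is realised on `X i`. [cite: GreenTao2008U3Inverse, §12, proof of Thm. 68] -/
theorem exists_real_correlation_on {ι : Type*} [Fintype ι] [DecidableEq ι] (X : ι → Nilmanifold 2)
    (Z : Nilmanifold 2)
    (huniv : ∀ (Φ : ∀ i, (X i).G ⧸ (X i).Γ → ℂ) (g : ∀ i, (X i).G) (p : ∀ i, (X i).G ⧸ (X i).Γ)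
        (M : ι → ℝ), (∀ i, 0 ≤ M i) → (∀ i y, ‖Φ i y‖ ≤ 1) →
        (∀ i y z, ‖Φ i y - Φ i z‖ ≤ M i * (X i).dist y z) →
        ∃ (Ψ : Z.G ⧸ Z.Γ → ℂ) (gZ : Z.G) (pZ : Z.G ⧸ Z.Γ),
          (∀ y, ‖Ψ y‖ ≤ 1) ∧ (∀ y z, ‖Ψ y - Ψ z‖ ≤ (∑ i, M i) * Z.dist y z) ∧
          ∀ n : ℤ, Ψ (gZ ^ n • pZ) = ∏ i, Φ i (g i ^ n • p i))
    {N : ℕ} [NeZero N] (hN : Odd N) (Gfac : ι → ℤ → ℂ) (M : ι → ℝ) (hM : ∀ i, 0 ≤ M i)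
    (hreal : ∀ i, ∃ (Φ : (X i).G ⧸ (X i).Γ → ℂ) (g : (X i).G) (p : (X i).G ⧸ (X i).Γ),
        (∀ y, ‖Φ y‖ ≤ 1) ∧ (∀ y z, ‖Φ y - Φ z‖ ≤ M i * (X i).dist y z) ∧
        ∀ n : ℤ, Φ (g ^ n • p) = Gfac i n)
    (G : ZMod N → ℂ) (hG : ∀ n : ℤ, G (n : ZMod N) = ∏ i, Gfac i n)
    (f : ZMod N → ℝ) (t : ZMod N) {c₀ : ℝ}
    (hcorr : c₀ * N ≤ ‖∑ x : ZMod N, ((f (x + t) : ℝ) : ℂ) * G x‖) :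
    ∃ (g : Z.G) (x₀ : Z.G ⧸ Z.Γ) (F : Z.G ⧸ Z.Γ → ℝ),
      Z.IsBoundedLipschitz (∑ i, M i) F ∧
        c₀ / 2 ≤ |(∑ n ∈ Finset.Icc (-((N : ℤ) / 2)) ((N : ℤ) / 2),
            f ((n : ZMod N) + t) * F (g ^ n • x₀)) / N| := by
  have hNpos : (0 : ℝ) < N := by exact_mod_cast Nat.pos_of_ne_zero (NeZero.ne N)
  choose Φ g p hb hL horb using hreal
  obtain ⟨Ψ, gZ, pZ, hΨb, hΨL, hΨorb⟩ := huniv Φ g p M hM hb hL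
  -- the correlation as a sum over representatives
  have hsum : ∑ x : ZMod N, ((f (x + t) : ℝ) : ℂ) * G x =
      ∑ n ∈ Finset.Icc (-((N : ℤ) / 2)) ((N : ℤ) / 2),
        ((f ((n : ZMod N) + t) : ℝ) : ℂ) * Ψ (gZ ^ n • pZ) := by
    rw [← sum_Icc_intCast_eq_sum_univ hN]
    refine Finset.sum_congr rfl fun n _ => ?_
    rw [hG n, hΨorb n]
    simp only [horb]
  rw [hsum] at hcorr
  rcases half_le_abs_re_sum_or_im_sum _ (fun n : ℤ => f ((n : ZMod N) + t))
      (fun n : ℤ => Ψ (gZ ^ n • pZ)) hcorr with hre | him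
  · refine ⟨gZ, pZ, fun y => (Ψ y).re, isBoundedLipschitz_re hΨb hΨL, ?_⟩
    rw [abs_div, abs_of_pos hNpos, le_div_iff₀ hNpos]
    have e : c₀ / 2 * N = c₀ * N / 2 := by ring
    rw [e]; exact hre
  · refine ⟨gZ, pZ, fun y => (Ψ y).im, isBoundedLipschitz_im hΨb hΨL, ?_⟩
    rw [abs_div, abs_of_pos hNpos, le_div_iff₀ hNpos]
    have e : c₀ / 2 * N = c₀ * N / 2 := by ring
    rw [e]; exact him

/-- The factor family of arXiv Thm. 68 lies in the Heisenberg class: circle, torus `𝕋 × 𝕋`, and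
`(𝕋 × 𝕋) × (H × H)`, according to the three kinds of factors (character, linear monomial, quadratic
monomial). [cite: GreenTao2008U3Inverse, §12, Examples 62–64 and Lemma 65] -/
theorem inHeisClass_factorFamily (H : Nilmanifold 2) (d : ℕ) :
    ∀ i : Unit ⊕ (Fin d ⊕ (Fin d × Fin d)),
      InHeisClass H
        (Sum.elim (fun _ => Nilmanifold.circle.ofLE (by norm_num : 1 ≤ 2))
          (Sum.elim
            (fun _ => (Nilmanifold.circle.ofLE (by norm_num : 1 ≤ 2)).prod
              (Nilmanifold.circle.ofLE (by norm_num : 1 ≤ 2)))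
            (fun _ => ((Nilmanifold.circle.ofLE (by norm_num : 1 ≤ 2)).prod
              (Nilmanifold.circle.ofLE (by norm_num : 1 ≤ 2))).prod (H.prod H))) i) := by
  rintro (_ | _ | _)
  · exact InHeisClass.circle
  · exact InHeisClass.prod InHeisClass.circle InHeisClass.circle
  · exact InHeisClass.prod (InHeisClass.prod InHeisClass.circle InHeisClass.circle)
      (InHeisClass.prod InHeisClass.heis InHeisClass.heis)

/-- **The factorised bracket correlation is a real nilsequence correlation on the fixed product
nilmanifold (arXiv §12, proof of Thm. 68, with Lemmas 65 and 69).**  Let `H = (H³(ℝ)/H³(ℤ), d)` be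
box-comparable with constant `L`, `X` the factor family for `d'` frequencies and `Z` a nilmanifold with
the universal tensoring property for `X`.  If `N` is odd, `κ : ℝ/ℤ → [0,1]` vanishes on `‖a‖ ≥ r₂`
(`r₂ ≤ 1/4`) and is `L_κ`-Lipschitz (`0 ≤ L_κ`), and
`c₀ N ≤ ‖∑_u f(u+t₁) e(uζ₁) ∏_l κ(uξ_l)e(B_l{uξ_l/N}) ∏_{l,l'} κκ·(κκ·e(A_{ll'}{uξ_l/N}{uξ_{l'}/N}))‖`, then
there are `g, x₀` and a real `F` on `Z`, `1`-bounded with Lipschitz constant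
`2π + d'((L_κ+2π+2/(½−r₂))+2π) + d'·d'·(2(L_κ+2π+2/(½−r₂)) + 2(4π+L_κ+2/(½−r₂))L)`, with
`c₀/2 ≤ |(∑_{n∈Icc(−N/2,N/2)} f(n+t₁) F(gⁿx₀))/N|`.
[cite: GreenTao2008U3Inverse, §12, proof of Thm. 68] -/
theorem exists_real_correlation_of_bracket (dH : HX → HX → ℝ) (h : IsCompatMetric dH) {L : ℝ}
    (hL : 0 ≤ L) (hcomp : ∀ p q, heisPreDist p q ≤ L * dH p q ∧ dH p q ≤ L * heisPreDist p q)
    (d : ℕ) (Z : Nilmanifold 2)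
    (huniv : ∀ (Φ : ∀ i : Unit ⊕ (Fin d ⊕ (Fin d × Fin d)),
          (Sum.elim (fun _ => Nilmanifold.circle.ofLE (by norm_num : 1 ≤ 2))
            (Sum.elim
              (fun _ => (Nilmanifold.circle.ofLE (by norm_num : 1 ≤ 2)).prod
                (Nilmanifold.circle.ofLE (by norm_num : 1 ≤ 2)))
              (fun _ => ((Nilmanifold.circle.ofLE (by norm_num : 1 ≤ 2)).prod
                (Nilmanifold.circle.ofLE (by norm_num : 1 ≤ 2))).prod
                  ((heisenbergWith dH h).prod (heisenbergWith dH h)))) i).G ⧸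
          (Sum.elim (fun _ => Nilmanifold.circle.ofLE (by norm_num : 1 ≤ 2))
            (Sum.elim
              (fun _ => (Nilmanifold.circle.ofLE (by norm_num : 1 ≤ 2)).prod
                (Nilmanifold.circle.ofLE (by norm_num : 1 ≤ 2)))
              (fun _ => ((Nilmanifold.circle.ofLE (by norm_num : 1 ≤ 2)).prod
                (Nilmanifold.circle.ofLE (by norm_num : 1 ≤ 2))).prod
                  ((heisenbergWith dH h).prod (heisenbergWith dH h)))) i).Γ → ℂ)
        (g : ∀ i, (Sum.elim (fun _ => Nilmanifold.circle.ofLE (by norm_num : 1 ≤ 2))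
            (Sum.elim
              (fun _ => (Nilmanifold.circle.ofLE (by norm_num : 1 ≤ 2)).prod
                (Nilmanifold.circle.ofLE (by norm_num : 1 ≤ 2)))
              (fun _ => ((Nilmanifold.circle.ofLE (by norm_num : 1 ≤ 2)).prod
                (Nilmanifold.circle.ofLE (by norm_num : 1 ≤ 2))).prod
                  ((heisenbergWith dH h).prod (heisenbergWith dH h)))) i).G)
        (p : ∀ i, (Sum.elim (fun _ => Nilmanifold.circle.ofLE (by norm_num : 1 ≤ 2))
            (Sum.elim
              (fun _ => (Nilmanifold.circle.ofLE (by norm_num : 1 ≤ 2)).prod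
                (Nilmanifold.circle.ofLE (by norm_num : 1 ≤ 2)))
              (fun _ => ((Nilmanifold.circle.ofLE (by norm_num : 1 ≤ 2)).prod
                (Nilmanifold.circle.ofLE (by norm_num : 1 ≤ 2))).prod
                  ((heisenbergWith dH h).prod (heisenbergWith dH h)))) i).G ⧸
          (Sum.elim (fun _ => Nilmanifold.circle.ofLE (by norm_num : 1 ≤ 2))
            (Sum.elim
              (fun _ => (Nilmanifold.circle.ofLE (by norm_num : 1 ≤ 2)).prod
                (Nilmanifold.circle.ofLE (by norm_num : 1 ≤ 2)))
              (fun _ => ((Nilmanifold.circle.ofLE (by norm_num : 1 ≤ 2)).prod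
                (Nilmanifold.circle.ofLE (by norm_num : 1 ≤ 2))).prod
                  ((heisenbergWith dH h).prod (heisenbergWith dH h)))) i).Γ)
        (M : Unit ⊕ (Fin d ⊕ (Fin d × Fin d)) → ℝ), (∀ i, 0 ≤ M i) → (∀ i y, ‖Φ i y‖ ≤ 1) →
        (∀ i y z, ‖Φ i y - Φ i z‖ ≤ M i *
          (Sum.elim (fun _ => Nilmanifold.circle.ofLE (by norm_num : 1 ≤ 2))
            (Sum.elim
              (fun _ => (Nilmanifold.circle.ofLE (by norm_num : 1 ≤ 2)).prod
                (Nilmanifold.circle.ofLE (by norm_num : 1 ≤ 2)))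
              (fun _ => ((Nilmanifold.circle.ofLE (by norm_num : 1 ≤ 2)).prod
                (Nilmanifold.circle.ofLE (by norm_num : 1 ≤ 2))).prod
                  ((heisenbergWith dH h).prod (heisenbergWith dH h)))) i).dist y z) →
        ∃ (Ψ : Z.G ⧸ Z.Γ → ℂ) (gZ : Z.G) (pZ : Z.G ⧸ Z.Γ),
          (∀ y, ‖Ψ y‖ ≤ 1) ∧ (∀ y z, ‖Ψ y - Ψ z‖ ≤ (∑ i, M i) * Z.dist y z) ∧
          ∀ n : ℤ, Ψ (gZ ^ n • pZ) = ∏ i, Φ i (g i ^ n • p i))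
    {N : ℕ} [NeZero N] (hN : Odd N) (ξ : Fin d → ZMod N) {κ : AddCircle (1 : ℝ) → ℝ}
    {r₂ Lκ : ℝ} (hκ : ∀ a, 0 ≤ κ a ∧ κ a ≤ 1) (hκ0 : ∀ a, r₂ ≤ ‖a‖ → κ a = 0) (hr₂ : r₂ ≤ 1 / 4)
    (hκL : ∀ a b, |κ a - κ b| ≤ Lκ * dist a b) (hLκ : 0 ≤ Lκ) (A : Fin d → Fin d → ℝ)
    (B : Fin d → ℝ) (ζ₁ t₁ : ZMod N) (f : ZMod N → ℝ) {c₀ : ℝ}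
    (hcorr : c₀ * N ≤
      ‖∑ u : ZMod N, ((f (u + t₁) : ℝ) : ℂ) *
          (((AddCircle.toCircle (ZMod.toAddCircle (u * ζ₁)) : Circle) : ℂ) *
            (∏ l, (κ (ZMod.toAddCircle (u * ξ l)) : ℂ) *
              ((AddCircle.toCircle (((B l * (((u * ξ l).valMinAbs : ℝ) / N) : ℝ)) :
                AddCircle (1 : ℝ)) : Circle) : ℂ)) *
            ∏ l, ∏ l', ((κ (ZMod.toAddCircle (u * ξ l)) : ℂ) * (κ (ZMod.toAddCircle (u * ξ l')) : ℂ)) *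
              (((κ (ZMod.toAddCircle (u * ξ l)) : ℂ) * (κ (ZMod.toAddCircle (u * ξ l')) : ℂ)) *
                ((AddCircle.toCircle (((A l l' * (((u * ξ l).valMinAbs : ℝ) / N) *
                  (((u * ξ l').valMinAbs : ℝ) / N) : ℝ)) : AddCircle (1 : ℝ)) : Circle) : ℂ)))‖) :
    ∃ (g : Z.G) (x₀ : Z.G ⧸ Z.Γ) (F : Z.G ⧸ Z.Γ → ℝ),
      Z.IsBoundedLipschitz (2 * Real.pi + d * ((Lκ + 2 * Real.pi + 2 / (1 / 2 - r₂)) + 2 * Real.pi) +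
        d * d * (2 * (Lκ + 2 * Real.pi + 2 / (1 / 2 - r₂)) +
          2 * ((4 * Real.pi + Lκ + 2 / (1 / 2 - r₂)) * L))) F ∧
        c₀ / 2 ≤ |(∑ n ∈ Finset.Icc (-((N : ℤ) / 2)) ((N : ℤ) / 2),
            f ((n : ZMod N) + t₁) * F (g ^ n • x₀)) / N| := by
  classical
  have hr : r₂ < 1 / 2 := by linarith
  have hgap : 0 < 1 / 2 - r₂ := by linarith
  -- the Lipschitz constants and the factors, indexed by the three kinds
  obtain ⟨M, hM⟩ : ∃ M : Unit ⊕ (Fin d ⊕ (Fin d × Fin d)) → ℝ,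
      M = Sum.elim (fun (_ : Unit) => 2 * Real.pi)
        (Sum.elim (fun (_ : Fin d) => (Lκ + 2 * Real.pi + 2 / (1 / 2 - r₂)) + 2 * Real.pi)
          (fun (_ : Fin d × Fin d) => 2 * (Lκ + 2 * Real.pi + 2 / (1 / 2 - r₂)) +
            2 * ((4 * Real.pi + Lκ + 2 / (1 / 2 - r₂)) * L))) := ⟨_, rfl⟩
  have hM0 : ∀ i, 0 ≤ M i := by
    rw [hM]
    rintro (_ | _ | _) <;> simp only [Sum.elim_inl, Sum.elim_inr] <;> positivity
  have hMsum : ∑ i, M i = 2 * Real.pi + d * ((Lκ + 2 * Real.pi + 2 / (1 / 2 - r₂)) + 2 * Real.pi) +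
      d * d * (2 * (Lκ + 2 * Real.pi + 2 / (1 / 2 - r₂)) +
        2 * ((4 * Real.pi + Lκ + 2 / (1 / 2 - r₂)) * L)) := by
    rw [hM, Fintype.sum_sum_type, Fintype.sum_sum_type]
    simp only [Sum.elim_inl, Sum.elim_inr, Finset.sum_const, Finset.card_univ, Fintype.card_unit,
      Fintype.card_fin, Fintype.card_prod, nsmul_eq_mul, Nat.cast_one, one_mul, Nat.cast_mul]
    ring
  obtain ⟨Gfac, hGfac⟩ : ∃ Gfac : Unit ⊕ (Fin d ⊕ (Fin d × Fin d)) → ℤ → ℂ,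
      Gfac = Sum.elim
        (fun (_ : Unit) (n : ℤ) => ((AddCircle.toCircle (ZMod.toAddCircle ((n : ZMod N) * ζ₁)) : Circle) : ℂ))
        (Sum.elim
          (fun (l : Fin d) (n : ℤ) => (κ (ZMod.toAddCircle ((n : ZMod N) * ξ l)) : ℂ) *
            ((AddCircle.toCircle (((B l * ((((n : ZMod N) * ξ l).valMinAbs : ℝ) / N) : ℝ)) :
              AddCircle (1 : ℝ)) : Circle) : ℂ))
          (fun (ll' : Fin d × Fin d) (n : ℤ) => ((κ (ZMod.toAddCircle ((n : ZMod N) * ξ ll'.1)) : ℂ) *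
              (κ (ZMod.toAddCircle ((n : ZMod N) * ξ ll'.2)) : ℂ)) *
            (((κ (ZMod.toAddCircle ((n : ZMod N) * ξ ll'.1)) : ℂ) *
                (κ (ZMod.toAddCircle ((n : ZMod N) * ξ ll'.2)) : ℂ)) *
              ((AddCircle.toCircle (((A ll'.1 ll'.2 *
                ((((n : ZMod N) * ξ ll'.1).valMinAbs : ℝ) / N) *
                ((((n : ZMod N) * ξ ll'.2).valMinAbs : ℝ) / N) : ℝ)) : AddCircle (1 : ℝ)) :
                  Circle) : ℂ)))) := ⟨_, rfl⟩
  set G : ZMod N → ℂ := fun u =>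
    (((AddCircle.toCircle (ZMod.toAddCircle (u * ζ₁)) : Circle) : ℂ) *
      (∏ l, (κ (ZMod.toAddCircle (u * ξ l)) : ℂ) *
        ((AddCircle.toCircle (((B l * (((u * ξ l).valMinAbs : ℝ) / N) : ℝ)) :
          AddCircle (1 : ℝ)) : Circle) : ℂ)) *
      ∏ l, ∏ l', ((κ (ZMod.toAddCircle (u * ξ l)) : ℂ) * (κ (ZMod.toAddCircle (u * ξ l')) : ℂ)) *
        (((κ (ZMod.toAddCircle (u * ξ l)) : ℂ) * (κ (ZMod.toAddCircle (u * ξ l')) : ℂ)) *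
          ((AddCircle.toCircle (((A l l' * (((u * ξ l).valMinAbs : ℝ) / N) *
            (((u * ξ l').valMinAbs : ℝ) / N) : ℝ)) : AddCircle (1 : ℝ)) : Circle) : ℂ))) with hGdef
  have hG : ∀ n : ℤ, G (n : ZMod N) = ∏ i, Gfac i n := by
    intro n
    rw [hGfac, Fintype.prod_sum_type, Fintype.prod_sum_type, Fintype.prod_prod_type]
    simp only [hGdef, Sum.elim_inl, Sum.elim_inr, Finset.prod_const, Finset.card_univ,
      Fintype.card_unit, pow_one]
    ring
  -- every factor is realised on its nilmanifold
  have hreal : ∀ i : Unit ⊕ (Fin d ⊕ (Fin d × Fin d)),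
      ∃ (Φ : (Sum.elim (fun _ => Nilmanifold.circle.ofLE (by norm_num : 1 ≤ 2))
            (Sum.elim
              (fun _ => (Nilmanifold.circle.ofLE (by norm_num : 1 ≤ 2)).prod
                (Nilmanifold.circle.ofLE (by norm_num : 1 ≤ 2)))
              (fun _ => ((Nilmanifold.circle.ofLE (by norm_num : 1 ≤ 2)).prod
                (Nilmanifold.circle.ofLE (by norm_num : 1 ≤ 2))).prod
                  ((heisenbergWith dH h).prod (heisenbergWith dH h)))) i).G ⧸
          (Sum.elim (fun _ => Nilmanifold.circle.ofLE (by norm_num : 1 ≤ 2))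
            (Sum.elim
              (fun _ => (Nilmanifold.circle.ofLE (by norm_num : 1 ≤ 2)).prod
                (Nilmanifold.circle.ofLE (by norm_num : 1 ≤ 2)))
              (fun _ => ((Nilmanifold.circle.ofLE (by norm_num : 1 ≤ 2)).prod
                (Nilmanifold.circle.ofLE (by norm_num : 1 ≤ 2))).prod
                  ((heisenbergWith dH h).prod (heisenbergWith dH h)))) i).Γ → ℂ)
        (g : (Sum.elim (fun _ => Nilmanifold.circle.ofLE (by norm_num : 1 ≤ 2))
            (Sum.elim
              (fun _ => (Nilmanifold.circle.ofLE (by norm_num : 1 ≤ 2)).prod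
                (Nilmanifold.circle.ofLE (by norm_num : 1 ≤ 2)))
              (fun _ => ((Nilmanifold.circle.ofLE (by norm_num : 1 ≤ 2)).prod
                (Nilmanifold.circle.ofLE (by norm_num : 1 ≤ 2))).prod
                  ((heisenbergWith dH h).prod (heisenbergWith dH h)))) i).G)
        (p : (Sum.elim (fun _ => Nilmanifold.circle.ofLE (by norm_num : 1 ≤ 2))
            (Sum.elim
              (fun _ => (Nilmanifold.circle.ofLE (by norm_num : 1 ≤ 2)).prod
                (Nilmanifold.circle.ofLE (by norm_num : 1 ≤ 2)))
              (fun _ => ((Nilmanifold.circle.ofLE (by norm_num : 1 ≤ 2)).prod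
                (Nilmanifold.circle.ofLE (by norm_num : 1 ≤ 2))).prod
                  ((heisenbergWith dH h).prod (heisenbergWith dH h)))) i).G ⧸
          (Sum.elim (fun _ => Nilmanifold.circle.ofLE (by norm_num : 1 ≤ 2))
            (Sum.elim
              (fun _ => (Nilmanifold.circle.ofLE (by norm_num : 1 ≤ 2)).prod
                (Nilmanifold.circle.ofLE (by norm_num : 1 ≤ 2)))
              (fun _ => ((Nilmanifold.circle.ofLE (by norm_num : 1 ≤ 2)).prod
                (Nilmanifold.circle.ofLE (by norm_num : 1 ≤ 2))).prod
                  ((heisenbergWith dH h).prod (heisenbergWith dH h)))) i).Γ),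
        (∀ y, ‖Φ y‖ ≤ 1) ∧
        (∀ y z, ‖Φ y - Φ z‖ ≤ M i *
          (Sum.elim (fun _ => Nilmanifold.circle.ofLE (by norm_num : 1 ≤ 2))
            (Sum.elim
              (fun _ => (Nilmanifold.circle.ofLE (by norm_num : 1 ≤ 2)).prod
                (Nilmanifold.circle.ofLE (by norm_num : 1 ≤ 2)))
              (fun _ => ((Nilmanifold.circle.ofLE (by norm_num : 1 ≤ 2)).prod
                (Nilmanifold.circle.ofLE (by norm_num : 1 ≤ 2))).prod
                  ((heisenbergWith dH h).prod (heisenbergWith dH h)))) i).dist y z) ∧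
        ∀ n : ℤ, Φ (g ^ n • p) = Gfac i n := by
    subst hM hGfac
    rintro (u | l | ⟨l, l'⟩) <;> dsimp only [Sum.elim_inl, Sum.elim_inr]
    · exact exists_character_on ζ₁ (by norm_num : 1 ≤ 2)
    · exact exists_bracket_linear_monomial_on hr hκ hκ0 hκL hLκ hN (ξ l) (B l)
    · exact exists_bracket_quad_monomial_on dH h hL hcomp hr hκ hκ0 hκL hLκ hN (ξ l) (ξ l') (A l l')
  have hcorr' : c₀ * N ≤ ‖∑ x : ZMod N, ((f (x + t₁) : ℝ) : ℂ) * G x‖ := by rw [hGdef]; exact hcorr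
  obtain ⟨g, x₀, F, hF, hc⟩ := exists_real_correlation_on _ Z huniv hN Gfac M hM0 hreal G hG f t₁ hcorr'
  refine ⟨g, x₀, F, ?_, hc⟩
  rw [hMsum] at hF
  exact hF

end Summit.Parity.GeneralizedHardyLittlewood.GreenTaoLevelTwoGITwoCyclicInverse
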